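import Summits.AtomisticToContinuum.Crystallization.Theorems.PricedLinkCensusStackingHingeRelaxedStarRigidityStretch

/-!
# Route `PricedLinkCensus`, crux `StackingHinge` (stmt-AtomisticToContinuum-14993), line `Sketch`:
# exact-star rigidity OFF the ideal ratio (`stub_relaxedStarRigidity`)

Pure geometry, no potential, no measure.  On the parameter box `189/200 ≤ a₀ ≤ 199/200`,
`77/100 ≤ h₀ ≤ 163/200` with `h₀ ≠ a₀ √(2/3)`, let `S ∋ 0` be a set in `ℝ³` such that at EVERY
`x ∈ S` the punctured `5/4`-ball of `S − x` is a (linearly) rotated copy of the relaxed reference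
star `refStar a₀ h₀` ("hcp-type": six in-layer struts of length `a₀`, six polar struts of length
`ρ = √(a₀²/3 + h₀²) ≠ a₀`) or of `a₀ • fccKissingPattern` ("fcc-type": twelve struts of length
`a₀`).  Then `S = A '' barlowStacking a₀ h s'` for a linear isometry `A`, a Hägg word `s'`, and
`h = h₀` (hcp-type origin) or `h = a₀ √(2/3)` (fcc-type origin).

Proof (files `…RelaxedStarRigidityStar`, `…Local`, `…Stretch`, and this file).

1. TYPES DO NOT MIX along stars (`not_fcc_of_adj`): a star point of an hcp-type point sees a
   point of `S` at distance `ρ ≠ a₀`, so it is not fcc-type.  Hence the star-component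
   `starComp S` of `0` is all hcp-type or all fcc-type.
2. FCC (`core_fcc`): all struts have length `a₀`, so `starComp S` is `a₀`-separated with ideal
   cuboctahedral shells; Hales's layer theorem (`barlow_of_idealShells`, from the PROVED
   `HalesDSP_layerPackings_holds`) makes it `A '' barlowStacking a₀ (a₀√(2/3)) s'`, whose covering
   radius `< a₀ < 5/4` swallows the rest of `S`.
3. HCP (`core_hcp`): normalise the origin's rotation to `1`.  The LAYER NORMAL PROPAGATES
   (`axial_of_adj`): every point of `starComp S` has rotation `A_x` with `A_x e₃ = ± e₃`.  The
   axialStretch `L = axialStretch (a₀√(2/3)/h₀)` along `e₃` commutes with all `A_x` and makes every star the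
   IDEAL anticuboctahedron `refStar a₀ (a₀√(2/3))`; windows survive because `‖L⁻¹ w‖ ≤ 5/4` for
   `‖w‖ ≤ a₀`.  Hales's theorem gives `L '' starComp S = A '' barlowStacking a₀ (a₀√(2/3)) s'`; the
   vectors `± u, ± v` of the stacking's layer through `0` land in the ideal star at `0` together
   with their antipodes, hence in its hexagon, so `A e₃ = ± e₃` (`axial_of_inPlane`), `L⁻¹`
   commutes with `A`, and `starComp S = A '' barlowStacking a₀ h₀ s'`; covering as in 2.

All `[folklore]` given the cited tree theorems.
-/

noncomputable section

namespace Summit.AtomisticToContinuum.Crystallization.Theorems.PricedHcpWindowsRelaxedStarRigidity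

open Literature.MathematicalPhysics.StatisticalMechanics Literature.Geometry.DiscreteGeometry
open Summit.AtomisticToContinuum.Crystallization.Theorems.PalmUnimodularRigidity.LayeredLawsSelectHcp
open Summit.AtomisticToContinuum.Crystallization.Theorems.PricedHcpWindowsIdealStarRigidity
open Summit.AtomisticToContinuum.Crystallization.Theorems.PricedHcpWindowsHcpLocalExactRigid
open Summit.AtomisticToContinuum.Crystallization.Theorems.PricedHcpWindowsBarlowShellSupport

section Core

variable {a h : ℝ} (ha₁ : 189 / 200 ≤ a) (ha₂ : a ≤ 199 / 200) (hh₁ : 77 / 100 ≤ h)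
  (hh₂ : h ≤ 163 / 200) (hne : h ≠ a * Real.sqrt (2 / 3))
include ha₁ ha₂ hh₁ hh₂ hne

/-- **The all-hcp case.**  If `0 ∈ S`, every point of `S` is hcp- or fcc-type, and the punctured
`5/4`-ball of `S` at `0` is EXACTLY `refStar a h` (`h ≠ a√(2/3)`), then
`S = A '' barlowStacking a h s'` for a linear isometry `A` and a Hägg word `s'`.  Types and layer
normals propagate along the star-component of `0`; the idealising stretch along `e₃` turns it
into a set with ideal anticuboctahedral shells, to which Hales's layer theorem applies; the
resulting rotation fixes `± e₃` (antipodal pairs of the ideal star at `0` are in-layer), so the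
stretch is undone inside the stacking; the covering radius closes up. [folklore] -/
theorem core_hcp {S : Set (EuclideanSpace ℝ (Fin 3))} (h0 : (0 : EuclideanSpace ℝ (Fin 3)) ∈ S)
    (hS : ∀ x ∈ S, ∃ A : EuclideanSpace ℝ (Fin 3) ≃ₗᵢ[ℝ] EuclideanSpace ℝ (Fin 3),
      pball S x = A '' (refStar a h : Set (EuclideanSpace ℝ (Fin 3))) ∨
        pball S x = A '' ((fun p : EuclideanSpace ℝ (Fin 3) => a • p) ''
          (fccKissingPattern : Set (EuclideanSpace ℝ (Fin 3)))))
    (hR : pball S 0 = (refStar a h : Set (EuclideanSpace ℝ (Fin 3)))) :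
    ∃ A : EuclideanSpace ℝ (Fin 3) ≃ₗᵢ[ℝ] EuclideanSpace ℝ (Fin 3), ∃ s' : ℤ → ℤ, IsHaggSeq s' ∧
      S = A '' barlowStacking a h s' := by
  have ha : 0 < a := by linarith
  have hh : 0 < h := by linarith
  -- (1) every point of the star-component is hcp-type with an axial rotation
  have good : ∀ z ∈ starComp S, ∃ A : EuclideanSpace ℝ (Fin 3) ≃ₗᵢ[ℝ] EuclideanSpace ℝ (Fin 3),
      z ∈ S ∧ pball S z = A '' (refStar a h : Set (EuclideanSpace ℝ (Fin 3))) ∧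
        (A layerAxis = layerAxis ∨ A layerAxis = -layerAxis) := by
    intro z hz
    induction hz with
    | refl =>
      refine ⟨LinearIsometryEquiv.refl ℝ _, h0, ?_, Or.inl rfl⟩
      rw [hR]
      simp
    | @tail p q _ hpq ih =>
      obtain ⟨hp, hqp⟩ := hpq
      obtain ⟨Ap, -, hPp, hAp⟩ := ih
      have hq : q ∈ S := mem_of_step hqp
      obtain ⟨Aq, hAq | hAq⟩ := hS q hq
      · exact ⟨Aq, hq, hAq, axial_of_adj ha₁ ha₂ hh₁ hh₂ hne hp hPp hAp hqp hAq⟩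
      · exact (not_fcc_of_adj ha₁ ha₂ hh₁ hh₂ hne hp hPp hqp hAq).elim
  choose! Arot hgood using good
  -- (2) the idealising stretch `f` and its inverse `g`
  set hI : ℝ := a * Real.sqrt (2 / 3) with hI_def
  have hIpos : 0 < hI := by positivity
  have hI_sq : hI ^ 2 = 2 / 3 * a ^ 2 := by
    rw [hI_def, mul_pow, Real.sq_sqrt (by norm_num : (0 : ℝ) ≤ 2 / 3)]; ring
  set f : ℝ := hI / h with hf_def
  set g : ℝ := h / hI with hg_def
  have hfh : f * h = hI := by rw [hf_def]; field_simp
  have hgI : g * hI = h := by rw [hg_def]; field_simp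
  have hgf : g * f = 1 := by rw [hg_def, hf_def]; field_simp
  have hfg : f * g = 1 := by rw [mul_comm, hgf]
  have hg2 : g ^ 2 * a ^ 2 = 3 / 2 * h ^ 2 := by
    have : g ^ 2 * hI ^ 2 = h ^ 2 := by rw [← mul_pow, hgI]
    rw [hI_sq] at this
    linarith
  have hback : ∀ z, axialStretch g (axialStretch f z) = z := fun z => by
    rw [axialStretch_comp, hgf, axialStretch_one]
  have hRIeq : axialStretch f '' (refStar a h : Set (EuclideanSpace ℝ (Fin 3))) =
      (refStar a hI : Set (EuclideanSpace ℝ (Fin 3))) := by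
    rw [axialStretch_image_refStar, hfh]
  have hRI : ∀ r ∈ (refStar a h : Set (EuclideanSpace ℝ (Fin 3))),
      axialStretch f r ∈ (refStar a hI : Set (EuclideanSpace ℝ (Fin 3))) := fun r hr => by
    rw [← hRIeq]; exact Set.mem_image_of_mem _ hr
  have hnI : ∀ y ∈ (refStar a hI : Set (EuclideanSpace ℝ (Fin 3))), ‖y‖ = a := fun y hy =>
    norm_of_mem_refStar ha.le hI_sq hy
  have hwin : ∀ w : EuclideanSpace ℝ (Fin 3), ‖w‖ ≤ a → ‖axialStretch g w‖ ≤ 5 / 4 := fun w hw =>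
    norm_axialStretch_le ha₁ ha₂ hh₁ hh₂ hg2 hw
  set V : Set (EuclideanSpace ℝ (Fin 3)) := axialStretch f '' starComp S with hV_def
  have hV0 : (0 : EuclideanSpace ℝ (Fin 3)) ∈ V := ⟨0, zero_mem_starComp S, axialStretch_zero f⟩
  -- a point `z ∈ S` whose stretch is within `a` of the stretch of `x ∈ starComp S` is a star point
  have hnear : ∀ x ∈ starComp S, ∀ z ∈ S, z ≠ x → ‖axialStretch f z - axialStretch f x‖ ≤ a →
      ∃ r ∈ (refStar a h : Set (EuclideanSpace ℝ (Fin 3))), z - x = Arot x r ∧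
        axialStretch f z - axialStretch f x = Arot x (axialStretch f r) := by
    intro x hx z hz hzx hn
    obtain ⟨hxS, hPx, hAx⟩ := hgood x hx
    have hd : dist z x ≤ 5 / 4 := by
      rw [dist_eq_norm, show z - x = axialStretch g (axialStretch f z - axialStretch f x) by
        rw [← axialStretch_sub, hback]]
      exact hwin _ hn
    have hmem := sub_mem_pball hz hzx hd
    rw [hPx] at hmem
    obtain ⟨r, hr, hre⟩ := hmem
    refine ⟨r, hr, hre.symm, ?_⟩
    rw [← axialStretch_sub, ← hre, axialStretch_map_of_axial hAx]
  -- (E2) separation of `V`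
  have hsep : ∀ x ∈ V, ∀ z ∈ V, x ≠ z → a ≤ dist x z := by
    rintro _ ⟨x, hx, rfl⟩ _ ⟨z, hz, rfl⟩ hne'
    by_contra hlt
    have hzx : z ≠ x := fun e => hne' (by rw [e])
    have hzS : z ∈ S := starComp_subset h0 hz
    obtain ⟨r, hr, -, hre⟩ := hnear x hx z hzS hzx
      (by rw [← dist_eq_norm, dist_comm]; exact (not_le.1 hlt).le)
    have : dist (axialStretch f x) (axialStretch f z) = a := by
      rw [dist_comm, dist_eq_norm, hre, LinearIsometryEquiv.norm_map]
      exact hnI _ (hRI r hr)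
    exact hlt this.ge
  -- (E3) shells of `V` are ideal anticuboctahedra
  have hshell : ∀ x ∈ V, ∃ A : EuclideanSpace ℝ (Fin 3) ≃ₗᵢ[ℝ] EuclideanSpace ℝ (Fin 3),
      {y : EuclideanSpace ℝ (Fin 3) | x + y ∈ V ∧ ‖y‖ = a} =
          A '' (refStar a (a * Real.sqrt (2 / 3)) : Set (EuclideanSpace ℝ (Fin 3))) ∨
        {y : EuclideanSpace ℝ (Fin 3) | x + y ∈ V ∧ ‖y‖ = a} =
          A '' ((fun p : EuclideanSpace ℝ (Fin 3) => a • p) ''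
            (fccKissingPattern : Set (EuclideanSpace ℝ (Fin 3)))) := by
    rintro _ ⟨x, hx, rfl⟩
    obtain ⟨hxS, hPx, hAx⟩ := hgood x hx
    refine ⟨Arot x, Or.inl ?_⟩
    ext y
    constructor
    · rintro ⟨⟨z, hz, hze⟩, hyn⟩
      have hzS : z ∈ S := starComp_subset h0 hz
      have hy : y = axialStretch f z - axialStretch f x := by rw [hze, add_sub_cancel_left]
      have hzx : z ≠ x := by
        rintro rfl
        rw [sub_self] at hy
        rw [hy, norm_zero] at hyn
        linarith
      obtain ⟨r, hr, -, hre⟩ := hnear x hx z hzS hzx (by rw [← hy, hyn])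
      exact ⟨axialStretch f r, hRI r hr, by rw [hy, hre]⟩
    · rintro ⟨rI, hrI, rfl⟩
      rw [← hRIeq] at hrI
      obtain ⟨r, hr, rfl⟩ := hrI
      have hmem : Arot x r ∈ pball S x := by rw [hPx]; exact Set.mem_image_of_mem _ hr
      have hstep : (x + Arot x r) - x ∈ pball S x := by rwa [add_sub_cancel_left]
      refine ⟨⟨x + Arot x r, mem_starComp_of_step hx hxS hstep, ?_⟩, ?_⟩
      · rw [axialStretch_add, axialStretch_map_of_axial hAx]
      · rw [LinearIsometryEquiv.norm_map]
        exact hnI _ (hRI r hr)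
  -- Hales, Dense Sphere Packings §1.3
  obtain ⟨A, s', hs', hVeq⟩ := barlow_of_idealShells ha hV0 hsep hshell
  -- (F) the rotation `A` fixes `± e₃`
  have hVa : ∀ y ∈ V, ‖y‖ = a → y ∈ (refStar a hI : Set (EuclideanSpace ℝ (Fin 3))) := by
    rintro _ ⟨x, hx, rfl⟩ hn
    have hxS : x ∈ S := starComp_subset h0 hx
    have hx0 : x ≠ 0 := by
      rintro rfl
      rw [axialStretch_zero, norm_zero] at hn
      linarith
    have hxn : ‖x‖ ≤ 5 / 4 := by rw [← hback x]; exact hwin _ hn.le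
    have hxP : x ∈ pball S 0 := mem_pball_iff.2 ⟨by rwa [zero_add], hx0, hxn⟩
    rw [hR] at hxP
    exact hRI x hxP
  obtain ⟨hnu, hnv, hnegu, hnegv, hu2, hv2, hdet⟩ := layer_zero_vectors a hI s' ha.le
  have hBV : ∀ i j : ℤ, A (barlowPos a hI s' 0 i j) ∈ V := fun i j => by
    rw [hVeq]; exact Set.mem_image_of_mem _ (barlowPos_mem _ _ _)
  have hAu2 : A (barlowPos a hI s' 0 1 0) 2 = 0 := by
    refine apply_two_eq_zero_of_neg_mem ha.ne' hIpos.ne'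
      (hVa _ (hBV 1 0) (by rw [LinearIsometryEquiv.norm_map, hnu])) ?_
    rw [← map_neg, ← hnegu]
    exact hVa _ (hBV (-1) 0) (by rw [LinearIsometryEquiv.norm_map, hnegu, norm_neg, hnu])
  have hAv2 : A (barlowPos a hI s' 0 0 1) 2 = 0 := by
    refine apply_two_eq_zero_of_neg_mem ha.ne' hIpos.ne'
      (hVa _ (hBV 0 1) (by rw [LinearIsometryEquiv.norm_map, hnv])) ?_
    rw [← map_neg, ← hnegv]
    exact hVa _ (hBV 0 (-1)) (by rw [LinearIsometryEquiv.norm_map, hnegv, norm_neg, hnv])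
  have hAax : A layerAxis = layerAxis ∨ A layerAxis = -layerAxis :=
    axial_of_inPlane A hu2 hv2 (by rw [hdet]; positivity) hAu2 hAv2
  -- (G) undo the stretch inside the stacking
  have hU : starComp S = A '' barlowStacking a h s' := by
    have e1 : starComp S = axialStretch g '' V := by
      rw [hV_def, Set.image_image]
      simp only [hback, Set.image_id']
    have e2 : barlowStacking a h s' = axialStretch g '' barlowStacking a hI s' := by
      rw [axialStretch_image_barlowStacking, hgI]
    rw [e1, hVeq, e2, Set.image_image, Set.image_image]
    exact Set.image_congr' fun z => axialStretch_map_of_axial hAax g z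
  -- (H) the covering radius swallows the rest of `S`
  have hSU : S ⊆ starComp S := by
    intro y hy
    obtain ⟨z, hz, hd⟩ := exists_mem_barlowStacking_dist_lt ha s' (A.symm (axialStretch f y))
    have hAz : A z ∈ V := by rw [hVeq]; exact Set.mem_image_of_mem _ hz
    obtain ⟨u', hu', hue⟩ := hAz
    have hd' : ‖axialStretch f y - axialStretch f u'‖ < a := by
      have e := A.symm.dist_map (axialStretch f y) (A z)
      rw [A.symm_apply_apply] at e
      rw [hue, ← dist_eq_norm, ← e]
      exact hd
    by_cases hyu : y = u'
    · rw [hyu]; exact hu'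
    · have hu'S : u' ∈ S := starComp_subset h0 hu'
      have hdist : dist y u' ≤ 5 / 4 := by
        rw [dist_eq_norm, show y - u' = axialStretch g (axialStretch f y - axialStretch f u') by
          rw [← axialStretch_sub, hback]]
        exact hwin _ hd'.le
      exact mem_starComp_of_step hu' hu'S (sub_mem_pball hy hyu hdist)
  refine ⟨A, s', hs', Set.Subset.antisymm (hU ▸ hSU) ?_⟩
  rw [← hU]
  exact starComp_subset h0

/-- **The all-fcc case.**  If `0 ∈ S`, every point of `S` is hcp- or fcc-type (`h ≠ a√(2/3)`), and
the punctured `5/4`-ball of `S` at `0` is a rotated `a • fccKissingPattern`, then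
`S = A '' barlowStacking a (a√(2/3)) s'`: the star-component of `0` is all fcc-type, hence
`a`-separated with ideal cuboctahedral shells; Hales's layer theorem and the covering radius
finish. [folklore] -/
theorem core_fcc {S : Set (EuclideanSpace ℝ (Fin 3))} (h0 : (0 : EuclideanSpace ℝ (Fin 3)) ∈ S)
    (hS : ∀ x ∈ S, ∃ A : EuclideanSpace ℝ (Fin 3) ≃ₗᵢ[ℝ] EuclideanSpace ℝ (Fin 3),
      pball S x = A '' (refStar a h : Set (EuclideanSpace ℝ (Fin 3))) ∨
        pball S x = A '' ((fun p : EuclideanSpace ℝ (Fin 3) => a • p) ''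
          (fccKissingPattern : Set (EuclideanSpace ℝ (Fin 3)))))
    {A0 : EuclideanSpace ℝ (Fin 3) ≃ₗᵢ[ℝ] EuclideanSpace ℝ (Fin 3)}
    (hF : pball S 0 = A0 '' ((fun p : EuclideanSpace ℝ (Fin 3) => a • p) ''
      (fccKissingPattern : Set (EuclideanSpace ℝ (Fin 3))))) :
    ∃ A : EuclideanSpace ℝ (Fin 3) ≃ₗᵢ[ℝ] EuclideanSpace ℝ (Fin 3), ∃ s' : ℤ → ℤ, IsHaggSeq s' ∧
      S = A '' barlowStacking a (a * Real.sqrt (2 / 3)) s' := by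
  have ha : 0 < a := by linarith
  have good : ∀ z ∈ starComp S, ∃ A : EuclideanSpace ℝ (Fin 3) ≃ₗᵢ[ℝ] EuclideanSpace ℝ (Fin 3),
      z ∈ S ∧ pball S z = A '' ((fun p : EuclideanSpace ℝ (Fin 3) => a • p) ''
        (fccKissingPattern : Set (EuclideanSpace ℝ (Fin 3)))) := by
    intro z hz
    induction hz with
    | refl => exact ⟨A0, h0, hF⟩
    | @tail p q _ hpq ih =>
      obtain ⟨hp, hqp⟩ := hpq
      obtain ⟨Ap, -, hPp⟩ := ih
      have hq : q ∈ S := mem_of_step hqp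
      obtain ⟨Aq, hAq | hAq⟩ := hS q hq
      · exact (not_fcc_of_adj ha₁ ha₂ hh₁ hh₂ hne hq hAq (step_symm hp hqp) hPp).elim
      · exact ⟨Aq, hq, hAq⟩
  choose! Arot hgood using good
  have hsep : ∀ x ∈ starComp S, ∀ z ∈ starComp S, x ≠ z → a ≤ dist x z := by
    intro x hx z hz hxz
    by_contra hlt
    obtain ⟨-, hPx⟩ := hgood x hx
    have hzS := (hgood z hz).1
    have hmem := sub_mem_pball hzS (Ne.symm hxz)
      (by rw [dist_comm]; linarith [not_le.1 hlt])
    rw [hPx] at hmem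
    have := norm_of_mem_image_fcc ha.le _ hmem
    rw [← dist_eq_norm, dist_comm] at this
    exact hlt this.ge
  have hshell : ∀ x ∈ starComp S,
      ∃ A : EuclideanSpace ℝ (Fin 3) ≃ₗᵢ[ℝ] EuclideanSpace ℝ (Fin 3),
      {y : EuclideanSpace ℝ (Fin 3) | x + y ∈ starComp S ∧ ‖y‖ = a} =
          A '' (refStar a (a * Real.sqrt (2 / 3)) : Set (EuclideanSpace ℝ (Fin 3))) ∨
        {y : EuclideanSpace ℝ (Fin 3) | x + y ∈ starComp S ∧ ‖y‖ = a} =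
          A '' ((fun p : EuclideanSpace ℝ (Fin 3) => a • p) ''
            (fccKissingPattern : Set (EuclideanSpace ℝ (Fin 3)))) := by
    intro x hx
    obtain ⟨hxS, hPx⟩ := hgood x hx
    refine ⟨Arot x, Or.inr ?_⟩
    ext y
    constructor
    · rintro ⟨hy, hyn⟩
      have hy0 : y ≠ 0 := by
        rintro rfl
        rw [norm_zero] at hyn
        linarith
      have : y ∈ pball S x :=
        mem_pball_iff.2 ⟨starComp_subset h0 hy, hy0, by rw [hyn]; linarith⟩
      rwa [hPx] at this
    · intro hy
      have hyP : y ∈ pball S x := by rw [hPx]; exact hy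
      exact ⟨mem_starComp_of_step hx hxS (by rwa [add_sub_cancel_left]),
        norm_of_mem_image_fcc ha.le _ hy⟩
  obtain ⟨A, s', hs', hU⟩ := barlow_of_idealShells ha (zero_mem_starComp S) hsep hshell
  have hSU : S ⊆ starComp S := by
    intro y hy
    obtain ⟨z, hz, hd⟩ := exists_mem_barlowStacking_dist_lt ha s' (A.symm y)
    have hAz : A z ∈ starComp S := by rw [hU]; exact Set.mem_image_of_mem _ hz
    have hd' : dist y (A z) < a := by
      have e := A.symm.dist_map y (A z)
      rw [A.symm_apply_apply] at e
      rw [← e]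
      exact hd
    by_cases hyu : y = A z
    · rw [hyu]; exact hAz
    · exact mem_starComp_of_step hAz (starComp_subset h0 hAz)
        (sub_mem_pball hy hyu (by linarith))
  refine ⟨A, s', hs', Set.Subset.antisymm (hU ▸ hSU) ?_⟩
  rw [← hU]
  exact starComp_subset h0

end Core

/-! ## The stub -/

/-- **stub_relaxedStarRigidity** (line `Sketch` of crux `StackingHinge`, pure geometry).  OFF THE
IDEAL RATIO `h₀ ≠ a₀ √(2/3)`: if `0 ∈ S` and at EVERY `x ∈ S` the punctured `5/4`-ball of `S − x`
is a rotated copy of the relaxed reference star `refStar a₀ h₀` or of `a₀ • fccKissingPattern`,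
then `S` is an exact rotated Barlow stacking `A '' barlowStacking a₀ h s'` with `h = h₀` (hcp-type
origin: `core_hcp`, after normalising the origin's rotation) or `h = a₀ √(2/3)` (fcc-type origin:
`core_fcc`).  Types do not mix along stars, the layer normal propagates, the idealising stretch
along `e₃` reduces to Hales, *Dense Sphere Packings* §1.3 (`barlow_of_idealShells`), and the
covering radius of the stacking swallows the rest of `S`. [folklore] -/
theorem stub_relaxedStarRigidity : ∀ a₀ h₀ : ℝ, 189 / 200 ≤ a₀ → a₀ ≤ 199 / 200 → 77 / 100 ≤ h₀ → h₀ ≤ 163 / 200 → h₀ ≠ a₀ * Real.sqrt (2 / 3) → ∀ S : Set (EuclideanSpace ℝ (Fin 3)), (0 : EuclideanSpace ℝ (Fin 3)) ∈ S → (∀ x ∈ S, ∃ A : EuclideanSpace ℝ (Fin 3) ≃ₗᵢ[ℝ] EuclideanSpace ℝ (Fin 3), ({y : EuclideanSpace ℝ (Fin 3) | y ∈ ((fun p : EuclideanSpace ℝ (Fin 3) => p - x) '' S) ∧ y ≠ 0 ∧ ‖y‖ ≤ 5 / 4} = A '' (↑(Summit.AtomisticToContinuum.Crystallization.Theorems.PalmUnimodularRigidity.LayeredLawsSelectHcp.refStar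 a₀ h₀) : Set (EuclideanSpace ℝ (Fin 3))) ∨ {y : EuclideanSpace ℝ (Fin 3) | y ∈ ((fun p : EuclideanSpace ℝ (Fin 3) => p - x) '' S) ∧ y ≠ 0 ∧ ‖y‖ ≤ 5 / 4} = A '' ((fun p : EuclideanSpace ℝ (Fin 3) => a₀ • p) '' (↑Literature.Geometry.DiscreteGeometry.fccKissingPattern : Set (EuclideanSpace ℝ (Fin 3)))))) → ∃ A : EuclideanSpace ℝ (Fin 3) ≃ₗᵢ[ℝ] EuclideanSpace ℝ (Fin 3), ∃ h : ℝ, (h = h₀ ∨ h = a₀ * Real.sqrt (2 / 3)) ∧ ∃ s' : ℤ → ℤ, Literature.MathematicalPhysics.StatisticalMechanics.IsHaggSeq s' ∧ S = A '' Literature.MathematicalPhysics.StatisticalMechanics.barlowStacking a₀ h s' := by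
  intro a₀ h₀ ha₁ ha₂ hh₁ hh₂ hne S h0 hS
  have hS' : ∀ x ∈ S, ∃ A : EuclideanSpace ℝ (Fin 3) ≃ₗᵢ[ℝ] EuclideanSpace ℝ (Fin 3),
      pball S x = A '' (refStar a₀ h₀ : Set (EuclideanSpace ℝ (Fin 3))) ∨
        pball S x = A '' ((fun p : EuclideanSpace ℝ (Fin 3) => a₀ • p) ''
          (fccKissingPattern : Set (EuclideanSpace ℝ (Fin 3)))) := hS
  obtain ⟨A0, hA0 | hA0⟩ := hS' 0 h0
  · -- hcp-type origin: normalise its rotation to the identity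
    have e2 : ∀ (B : EuclideanSpace ℝ (Fin 3) ≃ₗᵢ[ℝ] EuclideanSpace ℝ (Fin 3))
        (X : Set (EuclideanSpace ℝ (Fin 3))), A0.symm '' (B '' X) = (B.trans A0.symm) '' X :=
      fun B X => by rw [Set.image_image]; rfl
    have h0' : (0 : EuclideanSpace ℝ (Fin 3)) ∈ A0.symm '' S := ⟨0, h0, map_zero _⟩
    have hS'' : ∀ x ∈ A0.symm '' S,
        ∃ A : EuclideanSpace ℝ (Fin 3) ≃ₗᵢ[ℝ] EuclideanSpace ℝ (Fin 3),
        pball (A0.symm '' S) x = A '' (refStar a₀ h₀ : Set (EuclideanSpace ℝ (Fin 3))) ∨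
          pball (A0.symm '' S) x = A '' ((fun p : EuclideanSpace ℝ (Fin 3) => a₀ • p) ''
            (fccKissingPattern : Set (EuclideanSpace ℝ (Fin 3)))) := by
      rintro _ ⟨x, hx, rfl⟩
      obtain ⟨A, hA⟩ := hS' x hx
      refine ⟨A.trans A0.symm, ?_⟩
      rw [pball_image]
      rcases hA with hA | hA
      · left; rw [hA, e2]
      · right; rw [hA, e2]
    have hR' : pball (A0.symm '' S) 0 = (refStar a₀ h₀ : Set (EuclideanSpace ℝ (Fin 3))) := by
      have := pball_image A0.symm S 0
      rw [map_zero, hA0, Set.image_image] at this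
      rw [this]
      simp
    obtain ⟨A, s', hs', hSeq⟩ := core_hcp ha₁ ha₂ hh₁ hh₂ hne h0' hS'' hR'
    refine ⟨A.trans A0, h₀, Or.inl rfl, s', hs', ?_⟩
    calc S = A0 '' (A0.symm '' S) := by rw [Set.image_image]; simp
      _ = (A.trans A0) '' barlowStacking a₀ h₀ s' := by rw [hSeq, Set.image_image]; rfl
  · obtain ⟨A, s', hs', hSeq⟩ := core_fcc ha₁ ha₂ hh₁ hh₂ hne h0 hS' hA0
    exact ⟨A, _, Or.inr rfl, s', hs', hSeq⟩

end Summit.AtomisticToContinuum.Crystallization.Theorems.PricedHcpWindowsRelaxedStarRigidity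

end
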